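import Summits.AnomalousDissipation.AnomalousDissipation.Theorems.SawtoothPulseCascadeK1LocalisedCascadeChirpAbelSum
import Summits.AnomalousDissipation.AnomalousDissipation.Theorems.SawtoothPulseCascadeK1LocalisedCascadeTrapezoidTail

/-!
# K1loc, line `Spectral` / thin start — helper: OSCILLATORY BOUND FOR THE TRAPEZOID CUT-OFF OF THE EXACT `N`-TOOTH CHIRP (S-D, «Osc» 3/3)

Helper file of the prover lane on the crux `K1LocalisedCascade` (stmt-AnomalousDissipation-19491), route
`SawtoothPulseCascade` (S-D fibre ledger; constants of the twist cut-off half-step `…HalfStepVT/HT`, memo v14 §3(c)).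
The landed route bounds the mid-band cut-off `(ψ ⋆ g₀)(t) = ∫ k_ψ(s) g₀(t+s) ds` of the exact `N`-tooth chirp
`g₀(t) = exp(−2πiλ·tri(2πNt)/(2πN))` (`λ ∈ ℤ`) by the ABSOLUTE kernel tail, `≤ 2/(D·d)` off the corners.  Summing the tail WITH its
oscillation (`…ChirpCoeff`, `…ChirpAbelSum`) gives, for the maximal-ramp trapezoid `ψ = (L₁, L₂)`, `|λ| = L₂`, `D = L₂ − L₁`:
* `chirpCoeff_neg` (`C_{−ν}(q) = C_ν(−q)`), `two_mul_norm_coe_le_abs_sin` (`|sin πθ| ≥ 2‖θ‖`), `mul_le_norm_coe_of_phase_far`,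
  `half_le_norm_add_norm`;
* **`norm_circleCutoff_exactChirp_osc_le`** (sine form): `‖(ψ⋆g₀)(t)‖ ≤ (N/(πD))·(1/|sin π(Nt+¼)| + 1/|sin π(Nt−¼)|)`
  (`ĝ₀(Nq) = ĥ(q)` with `ĥ` the one-tooth chirp of strain `λ/N`, `…SidebandEnergy`; both signs of `λ`);
* **`norm_circleCutoff_exactChirp_osc_le_of_far`** (phase form, the socket of the half-step): if `2πNr ≤ |2πNt − (π/2 + πm)|` for all
  `m` (`r > 0`), then `‖(ψ⋆g₀)(t)‖ ≤ 1/(2πD·r) + 2N/(πD)`.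
So the corner envelope of the half-step gets the scale `d₀ ≈ 1/(2πAD)` instead of `4/(AD)` (junk energy `÷ 8π`, memo v14).
No definitions; nothing about the crux. [cite: Grafakos2014, Prop. 3.1.2 (5), §3.1.3] [problem: turb]
-/

-- `Summit.<Summit>.<Problem>`: single-conjunct summit, the duplicate namespace segment is deliberate.
set_option linter.dupNamespace false

noncomputable section

namespace Summit.AnomalousDissipation.AnomalousDissipation.Theorems.SawtoothPulseCascade.K1Window

open MeasureTheory Set Filter Topology Function Complex AddCircle intervalIntegral
open scoped Real
open Literature.Analysis Literature.Analysis.FunctionSpaces Literature.Analysis.FunctionSpaces.Torus Literature.Analysis.FluidPDE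
open Literature.Analysis.FluidPDE.SawtoothCascade
open Summit.AnomalousDissipation.AnomalousDissipation.Theorems.SawtoothPulseCascade.K1Start

/-! ## §5 The `N`-tooth chirp of integer frequency: reduction to §3 and the phase form -/

/-- **Reflection of the closed form**: `C_{−ν}(q) = C_ν(−q)` for the coefficient expression
`C_μ(q) = sin(π(μ+q)/2)/(π(μ+q)) + e^{−iπq}·sin(π(μ−q)/2)/(π(μ−q))` (`e^{−iπq} = e^{iπq}` for `q ∈ ℤ`). [folklore] -/
theorem chirpCoeff_neg (ν : ℝ) (q : ℤ) :
    ((Real.sin (π * (-ν + q) / 2) / (π * (-ν + q)) : ℝ) : ℂ) +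
        Complex.exp (-(π * I * q)) * ((Real.sin (π * (-ν - q) / 2) / (π * (-ν - q)) : ℝ) : ℂ) =
      ((Real.sin (π * (ν + ((-q : ℤ) : ℝ)) / 2) / (π * (ν + ((-q : ℤ) : ℝ))) : ℝ) : ℂ) +
        Complex.exp (-(π * I * ((-q : ℤ) : ℂ))) *
          ((Real.sin (π * (ν - ((-q : ℤ) : ℝ)) / 2) / (π * (ν - ((-q : ℤ) : ℝ))) : ℝ) : ℂ) := by
  have e1 : Real.sin (π * (-ν + q) / 2) / (π * (-ν + q)) =
      Real.sin (π * (ν + ((-q : ℤ) : ℝ)) / 2) / (π * (ν + ((-q : ℤ) : ℝ))) := by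
    push_cast
    rw [show π * (-ν + q) / 2 = -(π * (ν + -q) / 2) by ring, show π * (-ν + q) = -(π * (ν + -q)) by ring,
      Real.sin_neg, neg_div_neg_eq]
  have e2 : Real.sin (π * (-ν - q) / 2) / (π * (-ν - q)) =
      Real.sin (π * (ν - ((-q : ℤ) : ℝ)) / 2) / (π * (ν - ((-q : ℤ) : ℝ))) := by
    push_cast
    rw [show π * (-ν - q) / 2 = -(π * (ν - -q) / 2) by ring, show π * (-ν - q) = -(π * (ν - -q)) by ring,
      Real.sin_neg, neg_div_neg_eq]
  have e3 : Complex.exp (-(π * I * q)) = Complex.exp (-(π * I * ((-q : ℤ) : ℂ))) := by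
    rw [show (-(π * I * ((-q : ℤ) : ℂ)) : ℂ) = -(π * I * q) + q * (2 * π * I) by push_cast; ring,
      Complex.exp_add, Complex.exp_int_mul_two_pi_mul_I, mul_one]
  rw [e1, e2, e3]

/-- `|sin πθ| ≥ 2‖θ‖_{ℝ/ℤ}`. [folklore] -/
theorem two_mul_norm_coe_le_abs_sin (θ : ℝ) : 2 * ‖((θ : ℝ) : UnitAddCircle)‖ ≤ |Real.sin (π * θ)| := by
  have h := four_mul_norm_le_norm_fourier_one_sub_one ((θ : ℝ) : UnitAddCircle)
  rw [norm_fourier_coe_sub_one] at h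
  push_cast at h
  rw [mul_one] at h
  linarith

/-- **OSCILLATORY BOUND FOR THE TRAPEZOID CUT-OFF OF THE EXACT `N`-TOOTH CHIRP, sine form.**  `N ≥ 1`, `λ ∈ ℤ` with
`|λ| = L₂ > L₁`, `g₀(t) = exp(−2πiλ·tri(2πNt)/(2πN))` continuous on the circle, `ψ` the maximal-ramp trapezoid `(L₁, L₂)`
(plateau `|m| ≤ L₁`, foot `|m| = L₂`, `D = L₂ − L₁`).  Then for every `t` with `sin π(Nt ± ¼) ≠ 0`:
`‖∫ k_ψ(s) g₀(t+s) ds‖ ≤ (N/(πD))·(1/|sin π(Nt+¼)| + 1/|sin π(Nt−¼)|)`.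
(`ĝ₀(Nq) = ĥ(q)` for the one-tooth chirp `h` with strain `λ/N`, `…SidebandEnergy`; then §3–§4.)
[cite: Grafakos2014, Prop. 3.1.2 (5), §3.1.3] -/
theorem norm_circleCutoff_exactChirp_osc_le {N : ℕ} (hN : 0 < N) {lam : ℤ} {L₁ L₂ : ℕ} (hL₂ : lam.natAbs = L₂)
    (hL : L₁ < L₂) {g₀ : UnitAddCircle → ℂ} (hg₀c : Continuous g₀)
    (hg₀ : ∀ t : ℝ, g₀ (t : UnitAddCircle) = Complex.exp (-(2 * π * I * lam * ((tri (2 * π * N * t) / (2 * π * N) : ℝ) : ℂ))))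
    {ψ : ℤ → ℂ} (hψ : ∀ m : ℤ, ψ m = ((min 1 (max 0 (((L₂ : ℝ) - |(m : ℝ)|) / ((L₂ : ℝ) - L₁))) : ℝ) : ℂ))
    (t : ℝ) (hx₁ : Real.sin (π * (N * t + 1 / 4)) ≠ 0) (hx₂ : Real.sin (π * (N * t - 1 / 4)) ≠ 0) :
    ‖∫ s : UnitAddCircle, (∑ l ∈ Finset.Icc (-(L₂ : ℤ)) L₂, ψ l * fourier (-l) s) * g₀ ((t : UnitAddCircle) + s)‖ ≤
      (N : ℝ) / (π * ((L₂ : ℝ) - L₁)) * (1 / |Real.sin (π * (N * t + 1 / 4))| + 1 / |Real.sin (π * (N * t - 1 / 4))|) := by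
  classical
  have hπ : 0 < π := Real.pi_pos
  have hNr : (0 : ℝ) < N := by exact_mod_cast hN
  have hL2 : 1 ≤ L₂ := by omega
  have hL' : (L₁ : ℝ) < L₂ := by exact_mod_cast hL
  have hD : (0 : ℝ) < (L₂ : ℝ) - L₁ := by linarith
  -- the one-tooth chirp with strain `μ = λ/N`
  set μ : ℝ := (lam : ℝ) / N with hμ
  obtain ⟨h, hhc, hh⟩ := exists_exactChirp_real μ
  have hgh : g₀ = fun z : UnitAddCircle => h (N • z) := by
    funext z
    obtain ⟨u, rfl⟩ := QuotientAddGroup.mk_surjective z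
    have e : (N • (QuotientAddGroup.mk u : UnitAddCircle)) = (((N : ℝ) * u : ℝ) : UnitAddCircle) := by
      rw [show (QuotientAddGroup.mk u : UnitAddCircle) = ((u : ℝ) : UnitAddCircle) from rfl, nsmul_coe]
    rw [e, hh, show (QuotientAddGroup.mk u : UnitAddCircle) = ((u : ℝ) : UnitAddCircle) from rfl, hg₀]
    congr 1
    rw [hμ]
    push_cast
    field_simp
  -- the cut-off as a coefficient sum
  set S : Finset ℤ := Finset.Icc (-(L₂ : ℤ)) L₂ with hS
  rw [circleCutoff_eq_sum hg₀c ψ S]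
  -- the sampled trapezoid and the `q`-range
  set tt : ℤ → ℝ := fun q => min 1 (max 0 (((L₂ : ℝ) - |(N : ℝ) * q|) / ((L₂ : ℝ) - L₁))) with htt'
  have htt : ∀ q : ℤ, tt q = min 1 (max 0 (((L₂ : ℝ) - |(N : ℝ) * q|) / ((L₂ : ℝ) - L₁))) := fun q => rfl
  have hψN : ∀ q : ℤ, ψ ((N : ℤ) * q) = (tt q : ℂ) := fun q => by rw [hψ, htt]; push_cast; rfl
  obtain ⟨ht0, hte, hQμ, hanti, hbd⟩ := trapezoid_sample_facts hN hL htt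
  set Q : ℕ := (L₂ - 1) / N with hQdef
  have hNQ : N * Q < L₂ := by
    have h1 : N * Q ≤ L₂ - 1 := by rw [mul_comm]; exact Nat.div_mul_le_self (L₂ - 1) N
    omega
  have hNQ' : L₂ ≤ N * (Q + 1) := by
    have h1 : L₂ - 1 < N * (Q + 1) := by
      rw [mul_comm]; exact Nat.lt_mul_of_div_lt (Nat.lt_succ_self _) hN
    omega
  -- reduce the `l`-sum to the multiples `l = Nq`, `|q| ≤ Q`
  set f : ℤ → ℂ := fun l => ψ l * ((fourier l ((t : ℝ) : UnitAddCircle) : ℂ) * fourierCoeff g₀ l) with hf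
  have hvan : ∀ l ∈ S, l ∉ (Finset.Icc (-(Q : ℤ)) Q).image (fun q : ℤ => (N : ℤ) * q) → f l = 0 := by
    intro l hl hnot
    rw [hS, Finset.mem_Icc] at hl
    by_cases hdiv : (N : ℤ) ∣ l
    · -- a multiple of `N` outside `|q| ≤ Q` has `|l| ≥ L₂`, where the trapezoid vanishes
      obtain ⟨q, rfl⟩ := hdiv
      have hqQ : Q < |q| := by
        by_contra hle
        push Not at hle
        exact hnot (Finset.mem_image.mpr ⟨q, Finset.mem_Icc.mpr ⟨by linarith [neg_abs_le q], by
          linarith [le_abs_self q]⟩, rfl⟩)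
      have habs : (L₂ : ℤ) ≤ |(N : ℤ) * q| := by
        rw [abs_mul, Nat.abs_cast]
        have : (Q : ℤ) + 1 ≤ |q| := by omega
        have h2 : ((L₂ : ℕ) : ℤ) ≤ (N : ℤ) * ((Q : ℤ) + 1) := by exact_mod_cast hNQ'
        nlinarith [show (0 : ℤ) ≤ N from by positivity]
      have habs' : |(N : ℤ) * q| ≤ L₂ := abs_le.mpr ⟨hl.1, hl.2⟩
      have heq : |(((N : ℤ) * q : ℤ) : ℝ)| = L₂ := by
        rw [← Int.cast_abs]; exact_mod_cast le_antisymm habs' habs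
      have hψ0 : ψ ((N : ℤ) * q) = 0 := by
        rw [hψ, heq, sub_self, zero_div, max_self, min_eq_right zero_le_one]; simp
      simp only [hf, hψ0, zero_mul]
    · have h0 : fourierCoeff g₀ l = 0 := by rw [hgh]; exact fourierCoeff_comp_nsmul_eq_zero hN hhc hdiv
      simp only [hf, h0, mul_zero]
  have himg : (Finset.Icc (-(Q : ℤ)) Q).image (fun q : ℤ => (N : ℤ) * q) ⊆ S := by
    intro l hl
    obtain ⟨q, hq, rfl⟩ := Finset.mem_image.mp hl
    rw [Finset.mem_Icc] at hq
    rw [hS, Finset.mem_Icc]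
    have hNQz : (N : ℤ) * Q < L₂ := by exact_mod_cast hNQ
    have hN0 : (0 : ℤ) ≤ N := by positivity
    constructor <;> nlinarith
  have hred : ∑ l ∈ S, f l = ∑ q ∈ Finset.Icc (-(Q : ℤ)) Q, f ((N : ℤ) * q) := by
    rw [← Finset.sum_subset himg hvan, Finset.sum_image]
    intro q₁ _ q₂ _ h
    exact mul_left_cancel₀ (by exact_mod_cast hN.ne' : (N : ℤ) ≠ 0) h
  have hsum_f : ∑ l ∈ S, ψ l * ((fourier l ((t : ℝ) : UnitAddCircle) : ℂ) * fourierCoeff g₀ l) = ∑ l ∈ S, f l := rfl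
  rw [hsum_f, hred]
  -- each term: `ψ(Nq)·e_{Nq}(t)·ĝ₀(Nq) = tt(q)·C_μ(q)·e^{2πiq(Nt)}`
  have hμq : ∀ q ∈ Finset.Icc (-(Q : ℤ)) Q, μ + q ≠ 0 ∧ μ - q ≠ 0 := by
    intro q hq
    rw [Finset.mem_Icc] at hq
    have h1 : (-(Q : ℤ) : ℝ) ≤ q := by exact_mod_cast hq.1
    have h2 : (q : ℝ) ≤ Q := by exact_mod_cast hq.2
    push_cast at h1
    have hlam : (lam : ℝ) = L₂ ∨ (lam : ℝ) = -(L₂ : ℝ) := by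
      rcases Int.natAbs_eq lam with h | h <;> [left; right] <;> rw [h, hL₂] <;> push_cast <;> ring
    rcases hlam with h | h
    · have hμv : μ = (L₂ : ℝ) / N := by rw [hμ, h]
      rw [hμv]; constructor <;> linarith
    · have hμv : μ = -((L₂ : ℝ) / N) := by rw [hμ, h, neg_div]
      rw [hμv]; constructor <;> linarith
  have hterm : ∀ q ∈ Finset.Icc (-(Q : ℤ)) Q, f ((N : ℤ) * q) =
      (tt q : ℂ) * (((Real.sin (π * (μ + q) / 2) / (π * (μ + q)) : ℝ) : ℂ) +
        Complex.exp (-(π * I * q)) * ((Real.sin (π * (μ - q) / 2) / (π * (μ - q)) : ℝ) : ℂ)) *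
        Complex.exp (2 * π * I * q * (((N : ℝ) * t : ℝ) : ℂ)) := by
    intro q hq
    obtain ⟨h1, h2⟩ := hμq q hq
    have hc : fourierCoeff g₀ ((N : ℤ) * q) = fourierCoeff h q := by rw [hgh]; exact fourierCoeff_comp_nsmul_mul hN hhc q
    rw [hf]
    simp only
    rw [hψN, hc, fourierCoeff_exactChirp_eq hh hhc h1 h2, fourier_coe_apply]
    have e : Complex.exp (2 * π * I * (((N : ℤ) * q : ℤ) : ℂ) * ((t : ℝ) : ℂ) / ((1 : ℝ) : ℂ)) =
        Complex.exp (2 * π * I * q * (((N : ℝ) * t : ℝ) : ℂ)) := by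
      congr 1; push_cast; ring
    rw [e]; ring
  rw [Finset.sum_congr rfl hterm]
  -- the two signs of `λ`
  have hND : tt (-(Q : ℤ)) / ((L₂ : ℝ) / N - Q) / π ≤ (N : ℝ) / (π * ((L₂ : ℝ) - L₁)) := by
    rw [div_le_iff₀ hπ, show (N : ℝ) / (π * ((L₂ : ℝ) - L₁)) * π = (N : ℝ) / ((L₂ : ℝ) - L₁) by field_simp]
    exact hbd
  have hpos : 0 ≤ 1 / |Real.sin (π * (N * t + 1 / 4))| + 1 / |Real.sin (π * (N * t - 1 / 4))| := by positivity
  rcases Int.natAbs_eq lam with hl | hl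
  · -- `λ = L₂ > 0`
    have hμv : μ = (L₂ : ℝ) / N := by rw [hμ, hl, hL₂]; push_cast; ring
    have hmain := norm_sum_symbol_mul_chirpCoeff_le (μ := μ) (by rw [hμv]; exact hQμ) ht0 hte
      (by rw [hμv]; exact hanti) (x := (N : ℝ) * t) hx₁ hx₂
    refine hmain.trans ?_
    rw [hμv]
    exact mul_le_mul_of_nonneg_right hND hpos
  · -- `λ = −L₂ < 0`: reflect `q ↦ −q`
    have hμv : μ = -((L₂ : ℝ) / N) := by rw [hμ, hl, hL₂]; push_cast; ring
    set ν : ℝ := (L₂ : ℝ) / N with hν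
    have hrefl : ∑ q ∈ Finset.Icc (-(Q : ℤ)) Q, (tt q : ℂ) *
        (((Real.sin (π * (μ + q) / 2) / (π * (μ + q)) : ℝ) : ℂ) +
          Complex.exp (-(π * I * q)) * ((Real.sin (π * (μ - q) / 2) / (π * (μ - q)) : ℝ) : ℂ)) *
        Complex.exp (2 * π * I * q * (((N : ℝ) * t : ℝ) : ℂ)) =
        ∑ q ∈ Finset.Icc (-(Q : ℤ)) Q, (tt q : ℂ) *
        (((Real.sin (π * (ν + q) / 2) / (π * (ν + q)) : ℝ) : ℂ) +
          Complex.exp (-(π * I * q)) * ((Real.sin (π * (ν - q) / 2) / (π * (ν - q)) : ℝ) : ℂ)) *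
        Complex.exp (2 * π * I * q * ((-((N : ℝ) * t) : ℝ) : ℂ)) := by
      refine Finset.sum_nbij' (fun q => -q) (fun q => -q) (fun q hq => ?_) (fun q hq => ?_) (fun q _ => by simp)
        (fun q _ => by simp) (fun q hq => ?_)
      · rw [Finset.mem_Icc] at hq ⊢; omega
      · rw [Finset.mem_Icc] at hq ⊢; omega
      · rw [hμv, chirpCoeff_neg ν q, hte]
        have e : Complex.exp (2 * π * I * q * (((N : ℝ) * t : ℝ) : ℂ)) =
            Complex.exp (2 * π * I * ((-q : ℤ) : ℂ) * ((-((N : ℝ) * t) : ℝ) : ℂ)) := by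
          congr 1; push_cast; ring
        rw [e]
    rw [hrefl]
    have hx₁' : Real.sin (π * (-((N : ℝ) * t) + 1 / 4)) ≠ 0 := by
      rw [show π * (-((N : ℝ) * t) + 1 / 4) = -(π * (N * t - 1 / 4)) by ring, Real.sin_neg, neg_ne_zero]; exact hx₂
    have hx₂' : Real.sin (π * (-((N : ℝ) * t) - 1 / 4)) ≠ 0 := by
      rw [show π * (-((N : ℝ) * t) - 1 / 4) = -(π * (N * t + 1 / 4)) by ring, Real.sin_neg, neg_ne_zero]; exact hx₁
    have hmain := norm_sum_symbol_mul_chirpCoeff_le (μ := ν) hQμ ht0 hte hanti (x := -((N : ℝ) * t)) hx₁' hx₂'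
    refine hmain.trans ?_
    rw [show π * (-((N : ℝ) * t) + 1 / 4) = -(π * (N * t - 1 / 4)) by ring,
      show π * (-((N : ℝ) * t) - 1 / 4) = -(π * (N * t + 1 / 4)) by ring, Real.sin_neg, Real.sin_neg, abs_neg, abs_neg,
      add_comm (1 / |Real.sin (π * (N * t - 1 / 4))|)]
    exact mul_le_mul_of_nonneg_right hND hpos


/-- **Phase far from the corners ⇒ the two reduced phases `Nt ∓ ¼` are far from `ℤ`**: if `2πNr ≤ |2πNt − (π/2 + πm)|` for
every `m ∈ ℤ`, then `Nr ≤ ‖Nt − ¼‖_{ℝ/ℤ}` and `Nr ≤ ‖Nt + ¼‖_{ℝ/ℤ}` (`m = 2k`, resp. `m = 2k − 1`, `k = round(Nt ∓ ¼)`). [folklore] -/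
theorem mul_le_norm_coe_of_phase_far {N : ℕ} {t r : ℝ} (hfar : ∀ m : ℤ, 2 * π * N * r ≤ |2 * π * N * t - (π / 2 + π * m)|) :
    (N : ℝ) * r ≤ ‖(((N : ℝ) * t - 1 / 4 : ℝ) : UnitAddCircle)‖ ∧
      (N : ℝ) * r ≤ ‖(((N : ℝ) * t + 1 / 4 : ℝ) : UnitAddCircle)‖ := by
  have hπ : 0 < π := Real.pi_pos
  constructor
  · rw [UnitAddCircle.norm_eq]
    set k : ℤ := round ((N : ℝ) * t - 1 / 4)
    have h := hfar (2 * k)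
    rw [show 2 * π * N * t - (π / 2 + π * ((2 * k : ℤ) : ℝ)) = 2 * π * ((N : ℝ) * t - 1 / 4 - k) by push_cast; ring,
      abs_mul, abs_of_pos (by positivity : (0 : ℝ) < 2 * π)] at h
    nlinarith
  · rw [UnitAddCircle.norm_eq]
    set k : ℤ := round ((N : ℝ) * t + 1 / 4)
    have h := hfar (2 * k - 1)
    rw [show 2 * π * N * t - (π / 2 + π * ((2 * k - 1 : ℤ) : ℝ)) = 2 * π * ((N : ℝ) * t + 1 / 4 - k) by push_cast; ring,
      abs_mul, abs_of_pos (by positivity : (0 : ℝ) < 2 * π)] at h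
    nlinarith

/-- `‖Nt + ¼‖_{ℝ/ℤ} + ‖Nt − ¼‖_{ℝ/ℤ} ≥ ½` (the two points differ by `½`). [folklore] -/
theorem half_le_norm_add_norm (θ : ℝ) :
    1 / 2 ≤ ‖((θ + 1 / 4 : ℝ) : UnitAddCircle)‖ + ‖((θ - 1 / 4 : ℝ) : UnitAddCircle)‖ := by
  have h := norm_sub_le (((θ + 1 / 4 : ℝ) : UnitAddCircle)) (((θ - 1 / 4 : ℝ) : UnitAddCircle))
  have e : (((θ + 1 / 4 : ℝ) : UnitAddCircle)) - (((θ - 1 / 4 : ℝ) : UnitAddCircle)) = ((((1 : ℝ) / 2 : ℝ)) : UnitAddCircle) := by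
    rw [← AddCircle.coe_sub]; congr 1; ring
  have hhalf : ‖((((1 : ℝ) / 2 : ℝ)) : UnitAddCircle)‖ = 1 / 2 := by
    rw [AddCircle.norm_half_period_eq]; norm_num
  rw [e, hhalf] at h
  exact h

/-- **OSCILLATORY BOUND, phase form** (the socket of `…HalfStepVO/HO`): with the data of `norm_circleCutoff_exactChirp_osc_le`,
if the phase `2πNt` is at distance `≥ 2πNr` (`r > 0`) from every corner `π/2 + πm`, then
`‖∫ k_ψ(s) g₀(t+s) ds‖ ≤ 1/(2πD·r) + 2N/(πD)` (`D = L₂ − L₁`): the near reduced phase is `≥ Nr` from `ℤ`, the other `≥ ¼`,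
and `|sin πθ| ≥ 2‖θ‖`. [cite: Grafakos2014, Prop. 3.1.2 (5), §3.1.3] -/
theorem norm_circleCutoff_exactChirp_osc_le_of_far {N : ℕ} (hN : 0 < N) {lam : ℤ} {L₁ L₂ : ℕ} (hL₂ : lam.natAbs = L₂)
    (hL : L₁ < L₂) {g₀ : UnitAddCircle → ℂ} (hg₀c : Continuous g₀)
    (hg₀ : ∀ t : ℝ, g₀ (t : UnitAddCircle) = Complex.exp (-(2 * π * I * lam * ((tri (2 * π * N * t) / (2 * π * N) : ℝ) : ℂ))))
    {ψ : ℤ → ℂ} (hψ : ∀ m : ℤ, ψ m = ((min 1 (max 0 (((L₂ : ℝ) - |(m : ℝ)|) / ((L₂ : ℝ) - L₁))) : ℝ) : ℂ))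
    {t r : ℝ} (hr : 0 < r) (hfar : ∀ m : ℤ, 2 * π * N * r ≤ |2 * π * N * t - (π / 2 + π * m)|) :
    ‖∫ s : UnitAddCircle, (∑ l ∈ Finset.Icc (-(L₂ : ℤ)) L₂, ψ l * fourier (-l) s) * g₀ ((t : UnitAddCircle) + s)‖ ≤
      1 / (2 * π * ((L₂ : ℝ) - L₁) * r) + 2 * N / (π * ((L₂ : ℝ) - L₁)) := by
  have hπ : 0 < π := Real.pi_pos
  have hNr : (0 : ℝ) < N := by exact_mod_cast hN
  have hD : (0 : ℝ) < (L₂ : ℝ) - L₁ := by have h : (L₁ : ℝ) < L₂ := (by exact_mod_cast hL); linarith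
  obtain ⟨hmminus, hmplus⟩ := mul_le_norm_coe_of_phase_far hfar
  have hNr0 : 0 < (N : ℝ) * r := mul_pos hNr hr
  have hsplus := two_mul_norm_coe_le_abs_sin ((N : ℝ) * t + 1 / 4)
  have hsminus := two_mul_norm_coe_le_abs_sin ((N : ℝ) * t - 1 / 4)
  have hx₁ : Real.sin (π * (N * t + 1 / 4)) ≠ 0 := by
    intro h; rw [h, abs_zero] at hsplus; linarith
  have hx₂ : Real.sin (π * (N * t - 1 / 4)) ≠ 0 := by
    intro h; rw [h, abs_zero] at hsminus; linarith
  have hmain := norm_circleCutoff_exactChirp_osc_le hN hL₂ hL hg₀c hg₀ hψ t hx₁ hx₂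
  refine hmain.trans ?_
  -- `1/|s₊| + 1/|s₋| ≤ 1/(2Nr) + 2`
  have hhalf := half_le_norm_add_norm ((N : ℝ) * t)
  have hsum : 1 / |Real.sin (π * (N * t + 1 / 4))| + 1 / |Real.sin (π * (N * t - 1 / 4))| ≤ 1 / (2 * (N * r)) + 2 := by
    have hpplus : 0 < |Real.sin (π * (N * t + 1 / 4))| := abs_pos.mpr hx₁
    have hpminus : 0 < |Real.sin (π * (N * t - 1 / 4))| := abs_pos.mpr hx₂
    rcases le_or_gt (1 / 4 : ℝ) ‖(((N : ℝ) * t + 1 / 4 : ℝ) : UnitAddCircle)‖ with h4 | h4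
    · have h1 : 1 / |Real.sin (π * (N * t + 1 / 4))| ≤ 2 := by
        rw [div_le_iff₀ hpplus]; linarith
      have h2 : 1 / |Real.sin (π * (N * t - 1 / 4))| ≤ 1 / (2 * (N * r)) :=
        one_div_le_one_div_of_le (by positivity) (by linarith)
      linarith
    · have h4' : 1 / 4 ≤ ‖(((N : ℝ) * t - 1 / 4 : ℝ) : UnitAddCircle)‖ := by linarith
      have h1 : 1 / |Real.sin (π * (N * t - 1 / 4))| ≤ 2 := by
        rw [div_le_iff₀ hpminus]; linarith
      have h2 : 1 / |Real.sin (π * (N * t + 1 / 4))| ≤ 1 / (2 * (N * r)) :=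
        one_div_le_one_div_of_le (by positivity) (by linarith)
      linarith
  calc (N : ℝ) / (π * ((L₂ : ℝ) - L₁)) * (1 / |Real.sin (π * (N * t + 1 / 4))| + 1 / |Real.sin (π * (N * t - 1 / 4))|)
      ≤ (N : ℝ) / (π * ((L₂ : ℝ) - L₁)) * (1 / (2 * (N * r)) + 2) :=
        mul_le_mul_of_nonneg_left hsum (by positivity)
    _ = 1 / (2 * π * ((L₂ : ℝ) - L₁) * r) + 2 * N / (π * ((L₂ : ℝ) - L₁)) := by
        field_simp

end Summit.AnomalousDissipation.AnomalousDissipation.Theorems.SawtoothPulseCascade.K1Window
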